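import Literature.GroupTheory.CombinatorialGroupTheory.QuadraticWordsForm
import HarnessLib

/-!
# Gathering handles: the endgame of the classification of epimorphisms `π₁(S_g) ↠ F`

Topic `Literature/GroupTheory/CombinatorialGroupTheory`.  Let `w` be an alternating quadratic word
(every symbol occurs once with each sign) whose form is nondegenerate (`Nondeg w`, file
`QuadraticWordsForm`), and let `X` assign to every symbol a value in a group `G` such that `w`
becomes trivial after deleting the letters of the symbols with value `1` (a **terminal** pattern,
as produced by Zieschang's engine `QuadraticWordsEngine.exists_terminal`).  Then
(`exists_blocks_of_terminal`) there is an automorphism `Θ` of the free group on the symbols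
carrying a product of commutator blocks `∏ [x_{qᵢ}^{±1}, x_{zᵢ}^{±1}]`, a permutation of the
letters of `w`, to a conjugate of `w`, such that every `zᵢ` has trivial value under the
transformed assignment `X̂ ∘ Θ`.  This is the algebraic content of ZVC E 5.4 (the last step of the
proof of Thm. 5.2.8), carried out by the bifurcations of ZVC 3.2.2–3.2.4 (canonical normal form
3.2.6 by **gathering handles**, Brahana's / Dehn's procedure): an innermost pair
`p … p̄` of surviving letters encloses only trivial-valued letters `T`; nondegeneracy yields a
symbol `z` interlinked with `p` inside `T`; three transport moves (transvections of `z` by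
trivial-valued words, which keep the value of `z` trivial, and one transvection of `p`) gather
`p, z` into a commutator block, and the rest of the word stays terminal.

Main definitions and results:

* `transv_mk_transport_out`, `transv_mk_transport_in` — the two transport templates moving a
  segment between "before the first occurrence" and "after the second occurrence" of a symbol
  (companions of `transv_mk_transport_left/right`);
* `gather_caseI` — the three-move gathering of one handle (the bifurcations in the proof of
  ZVC 3.2.4);
* `conjOnAut` — conjugating a set of generators by a word avoiding them (used to re-absorb the
  conjugations produced by rotating the ungathered remainder);
* `Block`, `blocksWord` — commutator blocks `[x_q^{(s)}, x_z^{(σ)}]` and their product word;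
* `exists_gather_step`, `exists_blocks_of_terminal` — one gathering step with all bookkeeping,
  and the endgame by induction on the length of the remainder.

## References

* H. Zieschang, E. Vogt, H.-D. Coldewey, *Surfaces and Planar Discontinuous Groups*, LNM 835,
  Springer 1980, §3.2 (3.2.2–3.2.6), §5.2 (Thm. 5.2.8 and its proof, Cor. 5.2.13), E 5.4.
* R. I. Grigorchuk, P. F. Kurchanov, Classification of epimorphisms from fundamental groups of
  surfaces onto free groups, Math. Notes 48 (1990) — the theorem this endgame serves.
-/

namespace Literature.GroupTheory.CombinatorialGroupTheory

open List

variable {ι : Type*} [DecidableEq ι]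

/-! ### Two more transport templates -/

/-- **Transport of a segment from after the second occurrence to before the first**, realised
backwards: the transvection `ȳ ↦ ȳ·(mk D)⁻¹` (i.e. `y ↦ D·y`) carries `A y M ȳ D C` to
`A D y M ȳ C`. [cite: ZieschangVogtColdewey1980, 5.2.2–5.2.4] -/
theorem transv_mk_transport_out (k : ι) (s : Bool) (A M D C : List (ι × Bool))
    (hA : Avoids k A) (hM : Avoids k M) (hD : Avoids k D) (hC : Avoids k C) :
    transv k (!s) (FreeGroup.invRev D) hD.invRev
        (FreeGroup.mk (A ++ (k, s) :: (M ++ (k, !s) :: (D ++ C)))) =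
      FreeGroup.mk (A ++ D ++ (k, s) :: (M ++ (k, !s) :: C)) := by
  have e : sgen k s = (sgen k (!s))⁻¹ := by rw [sgen_not, inv_inv]
  simp only [mk_append, mk_cons_eq_sgen_mul, e, map_mul, map_inv, transv_mk_of_avoids _ _ _ _ hA,
    transv_mk_of_avoids _ _ _ _ hM, transv_mk_of_avoids _ _ _ _ hD, transv_mk_of_avoids _ _ _ _ hC,
    transv_sgen, ← FreeGroup.inv_mk]
  group

/-- **Transport of a segment from before the first occurrence to after the second**, realised
backwards: the transvection `ȳ ↦ ȳ·mk D` (i.e. `y ↦ D⁻¹·y`) carries `A D y M ȳ C` to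
`A y M ȳ D C`. [cite: ZieschangVogtColdewey1980, 5.2.2–5.2.4] -/
theorem transv_mk_transport_in (k : ι) (s : Bool) (A M D C : List (ι × Bool))
    (hA : Avoids k A) (hM : Avoids k M) (hD : Avoids k D) (hC : Avoids k C) :
    transv k (!s) D hD (FreeGroup.mk (A ++ D ++ (k, s) :: (M ++ (k, !s) :: C))) =
      FreeGroup.mk (A ++ (k, s) :: (M ++ (k, !s) :: (D ++ C))) := by
  have e : sgen k s = (sgen k (!s))⁻¹ := by rw [sgen_not, inv_inv]
  simp only [mk_append, mk_cons_eq_sgen_mul, e, map_mul, map_inv, transv_mk_of_avoids _ _ _ _ hA,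
    transv_mk_of_avoids _ _ _ _ hM, transv_mk_of_avoids _ _ _ _ hD, transv_mk_of_avoids _ _ _ _ hC,
    transv_sgen]
  group

/-- Rearranging the segments of a word is a permutation (count criterion). [folklore] -/
theorem perm_transport_out (y y' : ι × Bool) (A M D C : List (ι × Bool)) :
    (A ++ y :: (M ++ y' :: (D ++ C))) ~ (A ++ D ++ y :: (M ++ y' :: C)) := by
  rw [perm_iff_count]; intro a; simp only [count_append, count_cons]; omega

/-! ### Small word lemmas -/

omit [DecidableEq ι] in
/-- A one-letter word is a signed generator. [folklore] -/
theorem mk_singleton_eq_sgen (x : ι × Bool) : FreeGroup.mk [x] = sgen x.1 x.2 := by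
  rw [mk_cons_eq_sgen_mul, show (FreeGroup.mk [] : FreeGroup ι) = 1 from rfl, mul_one]

omit [DecidableEq ι] in
/-- An endomorphism fixing the generators of the symbols of a word fixes the word. [folklore] -/
theorem map_mk_eq_self_of_forall {F : Type*} [FunLike F (FreeGroup ι) (FreeGroup ι)]
    [MonoidHomClass F (FreeGroup ι) (FreeGroup ι)] (ψ : F) {L : List (ι × Bool)}
    (h : ∀ x ∈ L, ψ (FreeGroup.of x.1) = FreeGroup.of x.1) : ψ (FreeGroup.mk L) = FreeGroup.mk L := by
  induction L with
  | nil => exact map_one ψ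
  | cons x L ih =>
    rw [mk_cons_eq_sgen_mul, map_mul, ih fun y hy => h y (mem_cons_of_mem _ hy)]
    congr 1
    obtain ⟨i, _ | _⟩ := x
    · rw [sgen_false, map_inv, h _ mem_cons_self]
    · rw [sgen_true, h _ mem_cons_self]

omit [DecidableEq ι] in
/-- A word all of whose symbols have trivial value has trivial value. [folklore] -/
theorem lift_mk_eq_one_of_forall {G : Type*} [Group G] (X : ι → G) {L : List (ι × Bool)}
    (h : ∀ x ∈ L, X x.1 = 1) : FreeGroup.lift X (FreeGroup.mk L) = 1 := by
  induction L with
  | nil => exact map_one _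
  | cons x L ih =>
    rw [mk_cons_eq_sgen_mul, map_mul, ih fun y hy => h y (mem_cons_of_mem _ hy), mul_one]
    obtain ⟨i, _ | _⟩ := x
    · rw [sgen_false, map_inv, FreeGroup.lift_apply_of, h _ mem_cons_self, inv_one]
    · rw [sgen_true, FreeGroup.lift_apply_of, h _ mem_cons_self]

omit [DecidableEq ι] in
/-- `mk (M ++ N) = 1 ↔ mk (N ++ M) = 1`. [folklore] -/
theorem mk_append_eq_one_comm {M N : List (ι × Bool)} (h : FreeGroup.mk (M ++ N) = 1) :
    FreeGroup.mk (N ++ M) = 1 := by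
  rw [mk_append] at h ⊢; exact mul_eq_one_comm.1 h

/-! ### Gathering one handle -/

/-- The segments of the quadratic word `W₁ p T₁ ζ T₂ p̄ U ζ̄ V` avoid the symbols of `p` and `ζ`.
[folklore] -/
theorem caseI_avoids {w W₁ T₁ T₂ U V : List (ι × Bool)} {q z : ι} {s σ : Bool}
    (hw : w = W₁ ++ (q, s) :: (T₁ ++ (z, σ) :: (T₂ ++ (q, !s) :: (U ++ (z, !σ) :: V))))
    (hq : IsQuadratic w) :
    (Avoids q W₁ ∧ Avoids q T₁ ∧ Avoids q T₂ ∧ Avoids q U ∧ Avoids q V) ∧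
      (Avoids z W₁ ∧ Avoids z T₁ ∧ Avoids z T₂ ∧ Avoids z U ∧ Avoids z V) ∧ q ≠ z := by
  have hz : IsQuadratic ((W₁ ++ (q, s) :: T₁) ++ (z, σ) :: ((T₂ ++ (q, !s) :: U) ++ (z, !σ) :: V)) := by
    rw [hw] at hq; simpa using hq
  obtain ⟨hzA, hzB, hzV⟩ := hz.avoids_of_split
  rw [avoids_append, avoids_cons] at hzA hzB
  have hq' : IsQuadratic (W₁ ++ (q, s) :: ((T₁ ++ (z, σ) :: T₂) ++ (q, !s) :: (U ++ (z, !σ) :: V))) := by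
    rw [hw] at hq; simpa using hq
  obtain ⟨hqW₁, hqT, hqUV⟩ := hq'.avoids_of_split
  rw [avoids_append, avoids_cons] at hqT hqUV
  exact ⟨⟨hqW₁, hqT.1, hqT.2.2, hqUV.1, hqUV.2.2⟩, ⟨hzA.1, hzA.2.2, hzB.1, hzB.2.2, hzV⟩, hzA.2.1⟩

/-- **Gathering a handle** (the bifurcations `(μ₁σμ₂), (μ''τ⁻¹), (μσ⁻¹), (μτ)` of the proof of
ZVC 3.2.4, as transvections): in the quadratic word
`W₁ p T₁ ζ T₂ p̄ U ζ̄ V` (`p = x_q^{(s)}`, `ζ = x_z^{(σ)}`), three transports — `ζ ↦ ζ·T₂`,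
`ζ ↦ T₁·ζ`, `p̄ ↦ p̄·(U T₂)` — produce the word `W₁ U T₂ [p, ζ] T₁ V`; the composite automorphism
fixes all other generators and sends `ζ` to `T₁ ζ T₂`. [cite: ZieschangVogtColdewey1980, 3.2.4 (proof)] -/
theorem gather_caseI {w W₁ T₁ T₂ U V : List (ι × Bool)} {q z : ι} {s σ : Bool}
    (hw : w = W₁ ++ (q, s) :: (T₁ ++ (z, σ) :: (T₂ ++ (q, !s) :: (U ++ (z, !σ) :: V))))
    (hq : IsQuadratic w) :
    ∃ ψ : MulAut (FreeGroup ι),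
      ψ (FreeGroup.mk (W₁ ++ U ++ T₂ ++ (q, s) :: (z, σ) :: (q, !s) :: (z, !σ) :: (T₁ ++ V))) =
          FreeGroup.mk w ∧
      (∀ i, i ≠ q → i ≠ z → ψ (FreeGroup.of i) = FreeGroup.of i) ∧
      ψ (sgen z σ) = FreeGroup.mk (T₁ ++ (z, σ) :: T₂) := by
  obtain ⟨⟨hqW₁, hqT₁, hqT₂, hqU, hqV⟩, ⟨hzW₁, hzT₁, hzT₂, hzU, hzV⟩, hqz'⟩ := caseI_avoids hw hq
  have hzq : q ≠ z := hqz'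
  have hqz : z ≠ q := fun h => hqz' h.symm
  -- the three moves
  let ψ₁ := transv z σ T₂ hzT₂
  let ψ₂ := transv z (!σ) (FreeGroup.invRev T₁) hzT₁.invRev
  have hqE : Avoids q (U ++ T₂) := avoids_append.2 ⟨hqU, hqT₂⟩
  let ψ₃ := transv q (!s) (U ++ T₂) hqE
  have h₁ : ψ₁ (FreeGroup.mk ((W₁ ++ (q, s) :: T₁) ++ (z, σ) :: (((q, !s) :: U) ++ T₂ ++ (z, !σ) :: V))) =
      FreeGroup.mk w := by
    rw [hw]
    convert transv_mk_transport_left z σ (W₁ ++ (q, s) :: T₁) T₂ ((q, !s) :: U) V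
      (avoids_append.2 ⟨hzW₁, avoids_cons.2 ⟨hzq, hzT₁⟩⟩) hzT₂ (avoids_cons.2 ⟨hzq, hzU⟩) hzV using 2
    simp
  have h₂ : ψ₂ (FreeGroup.mk ((W₁ ++ [(q, s)]) ++ (z, σ) :: (((q, !s) :: (U ++ T₂)) ++ (z, !σ) :: (T₁ ++ V)))) =
      FreeGroup.mk ((W₁ ++ (q, s) :: T₁) ++ (z, σ) :: (((q, !s) :: U) ++ T₂ ++ (z, !σ) :: V)) := by
    convert transv_mk_transport_out z σ (W₁ ++ [(q, s)]) ((q, !s) :: (U ++ T₂)) T₁ V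
      (avoids_append.2 ⟨hzW₁, avoids_cons.2 ⟨hzq, avoids_nil z⟩⟩)
      (avoids_cons.2 ⟨hzq, avoids_append.2 ⟨hzU, hzT₂⟩⟩) hzT₁ hzV using 2
    simp
  have h₃ : ψ₃ (FreeGroup.mk (W₁ ++ (U ++ T₂) ++ (q, s) :: ([(z, σ)] ++ (q, !s) :: ((z, !σ) :: (T₁ ++ V))))) =
      FreeGroup.mk ((W₁ ++ [(q, s)]) ++ (z, σ) :: (((q, !s) :: (U ++ T₂)) ++ (z, !σ) :: (T₁ ++ V))) := by
    convert transv_mk_transport_in q s W₁ [(z, σ)] (U ++ T₂) ((z, !σ) :: (T₁ ++ V)) hqW₁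
      (avoids_cons.2 ⟨hqz, avoids_nil q⟩) hqE (avoids_cons.2 ⟨hqz, avoids_append.2 ⟨hqT₁, hqV⟩⟩) using 2
    simp
  refine ⟨ψ₁ * ψ₂ * ψ₃, ?_, ?_, ?_⟩
  · rw [MulAut.mul_apply, MulAut.mul_apply]
    have : FreeGroup.mk (W₁ ++ U ++ T₂ ++ (q, s) :: (z, σ) :: (q, !s) :: (z, !σ) :: (T₁ ++ V)) =
        FreeGroup.mk (W₁ ++ (U ++ T₂) ++ (q, s) :: ([(z, σ)] ++ (q, !s) :: ((z, !σ) :: (T₁ ++ V)))) := by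
      simp
    rw [this, h₃, h₂, h₁]
  · intro i hiq hiz
    rw [MulAut.mul_apply, MulAut.mul_apply, transv_of_ne _ _ _ _ hiq, transv_of_ne _ _ _ _ hiz,
      transv_of_ne _ _ _ _ hiz]
  · rw [MulAut.mul_apply, MulAut.mul_apply]
    have e₃ : ψ₃ (sgen z σ) = sgen z σ := by
      rw [← mk_singleton_eq_sgen (z, σ)]
      exact transv_mk_of_avoids _ _ _ _ (avoids_cons.2 ⟨hqz, avoids_nil q⟩)
    have e₂ : ψ₂ (sgen z σ) = FreeGroup.mk T₁ * sgen z σ := by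
      have : sgen z σ = (sgen z (!σ))⁻¹ := by rw [sgen_not, inv_inv]
      rw [this, map_inv, transv_sgen, mul_inv_rev, FreeGroup.inv_mk, FreeGroup.invRev_invRev]
    rw [e₃, e₂, map_mul, transv_mk_of_avoids _ _ _ _ hzT₁, transv_sgen, mk_append, mk_cons_eq_sgen_mul]

/-! ### Conjugating a set of generators -/

/-- The endomorphism conjugating the generators in `p` by `c` and fixing the others. [folklore] -/
def conjOn (p : ι → Prop) [DecidablePred p] (c : FreeGroup ι) : FreeGroup ι →* FreeGroup ι :=
  FreeGroup.lift fun i => if p i then c * FreeGroup.of i * c⁻¹ else FreeGroup.of i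

omit [DecidableEq ι] in
/-- `conjOn p c` fixes words avoiding `p`. [folklore] -/
theorem conjOn_mk_of_forall_not (p : ι → Prop) [DecidablePred p] (c : FreeGroup ι) {L : List (ι × Bool)}
    (h : ∀ x ∈ L, ¬ p x.1) : conjOn p c (FreeGroup.mk L) = FreeGroup.mk L :=
  map_mk_eq_self_of_forall _ fun x hx => by rw [conjOn, FreeGroup.lift_apply_of, if_neg (h x hx)]

omit [DecidableEq ι] in
/-- `conjOn p c` conjugates words all of whose symbols lie in `p`. [folklore] -/
theorem conjOn_mk_of_forall (p : ι → Prop) [DecidablePred p] (c : FreeGroup ι) {L : List (ι × Bool)}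
    (h : ∀ x ∈ L, p x.1) : conjOn p c (FreeGroup.mk L) = c * FreeGroup.mk L * c⁻¹ := by
  induction L with
  | nil => rw [show (FreeGroup.mk [] : FreeGroup ι) = 1 from rfl, map_one]; group
  | cons x L ih =>
    rw [mk_cons_eq_sgen_mul, map_mul, ih fun y hy => h y (mem_cons_of_mem _ hy)]
    have hx : conjOn p c (sgen x.1 x.2) = c * sgen x.1 x.2 * c⁻¹ := by
      obtain ⟨i, _ | _⟩ := x
      · rw [sgen_false, map_inv, conjOn, FreeGroup.lift_apply_of, if_pos (h _ mem_cons_self)]; group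
      · rw [sgen_true, conjOn, FreeGroup.lift_apply_of, if_pos (h _ mem_cons_self)]
    rw [hx]; group

omit [DecidableEq ι] in
/-- `conjOn` on a generator. [folklore] -/
theorem conjOn_of (p : ι → Prop) [DecidablePred p] (c : FreeGroup ι) (i : ι) :
    conjOn p c (FreeGroup.of i) = if p i then c * FreeGroup.of i * c⁻¹ else FreeGroup.of i :=
  FreeGroup.lift_apply_of

omit [DecidableEq ι] in
/-- Conjugating by `c⁻¹` undoes conjugating by `c = mk C`, `C` avoiding `p`. [folklore] -/
private theorem conjOn_inv_comp (p : ι → Prop) [DecidablePred p] (C : List (ι × Bool))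
    (hC : ∀ x ∈ C, ¬ p x.1) :
    (conjOn p (FreeGroup.mk C)⁻¹).comp (conjOn p (FreeGroup.mk C)) = MonoidHom.id _ := by
  ext i
  simp only [MonoidHom.coe_comp, Function.comp_apply, MonoidHom.id_apply]
  by_cases hi : p i
  · rw [conjOn_of, if_pos hi, map_mul, map_mul, map_inv, conjOn_of, if_pos hi,
      conjOn_mk_of_forall_not p _ hC]
    group
  · rw [conjOn_of, if_neg hi, conjOn_of, if_neg hi]

omit [DecidableEq ι] in
/-- Conjugating by `c = mk C` undoes conjugating by `c⁻¹`, `C` avoiding `p`. [folklore] -/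
private theorem conjOn_comp_inv (p : ι → Prop) [DecidablePred p] (C : List (ι × Bool))
    (hC : ∀ x ∈ C, ¬ p x.1) :
    (conjOn p (FreeGroup.mk C)).comp (conjOn p (FreeGroup.mk C)⁻¹) = MonoidHom.id _ := by
  ext i
  simp only [MonoidHom.coe_comp, Function.comp_apply, MonoidHom.id_apply]
  by_cases hi : p i
  · rw [conjOn_of, if_pos hi, inv_inv, map_mul, map_mul, map_inv, conjOn_of, if_pos hi,
      conjOn_mk_of_forall_not p _ hC]
    group
  · rw [conjOn_of, if_neg hi, conjOn_of, if_neg hi]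

/-- **Conjugation of the generators in `p` by a word avoiding `p`**, as an automorphism.
[folklore] -/
noncomputable def conjOnAut (p : ι → Prop) [DecidablePred p] (C : List (ι × Bool))
    (hC : ∀ x ∈ C, ¬ p x.1) : MulAut (FreeGroup ι) :=
  MonoidHom.toMulEquiv (conjOn p (FreeGroup.mk C)) (conjOn p (FreeGroup.mk C)⁻¹)
    (conjOn_inv_comp p C hC) (conjOn_comp_inv p C hC)

omit [DecidableEq ι] in
/-- `conjOnAut` acts as `conjOn`. [folklore] -/
theorem conjOnAut_apply (p : ι → Prop) [DecidablePred p] (C : List (ι × Bool)) (hC : ∀ x ∈ C, ¬ p x.1)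
    (x : FreeGroup ι) : conjOnAut p C hC x = conjOn p (FreeGroup.mk C) x := rfl

/-! ### Blocks -/

/-- A commutator block `[x_q^{(s)}, x_z^{(σ)}]`: the symbol `q` of the first slot, the symbol `z`
of the second (the one to be killed), and their signs. [folklore] -/
structure Block (ι : Type*) where
  /-- the first symbol -/
  q : ι
  /-- the sign of the first symbol -/
  s : Bool
  /-- the second symbol -/
  z : ι
  /-- the sign of the second symbol -/
  σ : Bool

/-- The word `x_q^{(s)} x_z^{(σ)} x_q^{(!s)} x_z^{(!σ)}` of a block. [folklore] -/
def Block.word (b : Block ι) : List (ι × Bool) := [(b.q, b.s), (b.z, b.σ), (b.q, !b.s), (b.z, !b.σ)]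

/-- The product word `∏ [x_{qᵢ}^{(sᵢ)}, x_{zᵢ}^{(σᵢ)}]` of a list of blocks. [folklore] -/
def blocksWord (bs : List (Block ι)) : List (ι × Bool) := bs.flatMap Block.word

omit [DecidableEq ι] in
/-- `blocksWord` of no blocks. [folklore] -/
@[simp] theorem blocksWord_nil : blocksWord ([] : List (Block ι)) = [] := rfl

omit [DecidableEq ι] in
/-- `blocksWord` of an appended list. [folklore] -/
theorem blocksWord_append (bs bs' : List (Block ι)) :
    blocksWord (bs ++ bs') = blocksWord bs ++ blocksWord bs' := by
  simp [blocksWord, flatMap_append]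

omit [DecidableEq ι] in
/-- `blocksWord` of a single block. [folklore] -/
@[simp] theorem blocksWord_singleton (b : Block ι) : blocksWord [b] = b.word := by
  simp [blocksWord]

omit [DecidableEq ι] in
/-- The length of a product of blocks. [folklore] -/
theorem length_blocksWord (bs : List (Block ι)) : (blocksWord bs).length = 4 * bs.length := by
  induction bs with
  | nil => rfl
  | cons b bs ih =>
    rw [blocksWord, flatMap_cons, length_append, ← blocksWord, ih]
    simp [Block.word]; omega

omit [DecidableEq ι] in
/-- A block word contains the formal inverse of each of its letters. [folklore] -/
theorem Block.partner_mem_word (b : Block ι) {x : ι × Bool} (hx : x ∈ b.word) : (x.1, !x.2) ∈ b.word := by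
  simp only [Block.word, mem_cons, not_mem_nil, or_false] at hx ⊢
  rcases hx with rfl | rfl | rfl | rfl <;> simp

omit [DecidableEq ι] in
/-- A product of blocks contains the formal inverse of each of its letters. [folklore] -/
theorem partner_mem_blocksWord {bs : List (Block ι)} {x : ι × Bool} (hx : x ∈ blocksWord bs) :
    (x.1, !x.2) ∈ blocksWord bs := by
  simp only [blocksWord, mem_flatMap] at hx ⊢
  obtain ⟨b, hb, hxb⟩ := hx
  exact ⟨b, hb, b.partner_mem_word hxb⟩

/-! ### Choosing the pair to gather -/

omit [DecidableEq ι] in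
/-- A nonempty trivial word contains an adjacent cancelling pair `x^{(b)} x^{(!b)}`. [folklore] -/
theorem exists_adjacent_cancel {L : List (ι × Bool)} (h1 : FreeGroup.mk L = 1) (hne : L ≠ []) :
    ∃ (L₁ : List (ι × Bool)) (k : ι) (b : Bool) (L₂ : List (ι × Bool)), L = L₁ ++ (k, b) :: (k, !b) :: L₂ := by
  classical
  have hred : FreeGroup.Red L [] := by
    have h := FreeGroup.reduce.sound (L₁ := L) (L₂ := []) (by rw [h1]; rfl)
    have hr := FreeGroup.reduce.red (L := L)
    rwa [h, FreeGroup.reduce_nil] at hr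
  rcases hred.cases_head with h | ⟨L', hstep, -⟩
  · exact absurd h hne
  · cases hstep with
    | not => exact ⟨_, _, _, _, rfl⟩

/-- **The innermost pair.**  In a quadratic word which becomes trivial after deleting the letters
of value `1`, some symbol `q` occurs as `… q^{(s)} T q^{(!s)} …` with all letters of `T` of value
`1` (proof of ZVC 5.2.8, orientable case: between the two letters of an innermost essential
factor only inessential factors remain). [cite: ZieschangVogtColdewey1980, 5.2.8 (proof)] -/
theorem exists_innermost {G : Type*} [Group G] [DecidableEq G] (X : ι → G) {R : List (ι × Bool)}
    (hq : IsQuadratic R) (hne : R ≠ [])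
    (hZ : FreeGroup.mk (R.filter fun x => decide ¬ (X x.1 = 1)) = 1) :
    ∃ (W₁ T W₂ : List (ι × Bool)) (q : ι) (s : Bool),
      R = W₁ ++ (q, s) :: (T ++ (q, !s) :: W₂) ∧ ∀ x ∈ T, X x.1 = 1 := by
  by_cases hnil : (R.filter fun x => decide ¬ (X x.1 = 1)) = []
  · obtain ⟨x, R', rfl⟩ := exists_cons_of_ne_nil hne
    have hall : ∀ y ∈ x :: R', X y.1 = 1 := fun y hy => by
      simpa using filter_eq_nil_iff.1 hnil y hy
    have hp : (x.1, !x.2) ∈ x :: R' := hq.partner_mem mem_cons_self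
    rcases mem_cons.1 hp with h | h
    · have := congrArg Prod.snd h
      cases hx : x.2 <;> simp [hx] at this
    · obtain ⟨T, W₂, rfl⟩ := append_of_mem h
      exact ⟨[], T, W₂, x.1, x.2, by simp, fun y hy => hall y (by simp [hy])⟩
  · obtain ⟨L₁, k, b, L₂, hL⟩ := exists_adjacent_cancel hZ hnil
    obtain ⟨r₁, r₂, rfl, -, hr₂⟩ := filter_eq_append_iff.1 hL
    obtain ⟨s₁, s₂, rfl, -, -, hs₂⟩ := filter_eq_cons_iff.1 hr₂
    obtain ⟨T, s₃, rfl, hT, -, -⟩ := filter_eq_cons_iff.1 hs₂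
    refine ⟨r₁ ++ s₁, T, s₃, k, b, by simp, fun y hy => ?_⟩
    simpa using hT y hy

/-! ### One gathering step -/

omit [DecidableEq ι] in
/-- `mk (N ++ M) = (mk M)⁻¹ · mk (M ++ N) · mk M`. [folklore] -/
theorem mk_append_comm_eq_conj (M N : List (ι × Bool)) :
    FreeGroup.mk (N ++ M) = (FreeGroup.mk M)⁻¹ * FreeGroup.mk (M ++ N) * FreeGroup.mk M := by
  rw [mk_append, mk_append]; group

omit [DecidableEq ι] in
/-- Deleting an adjacent cancelling pair does not change the element. [folklore] -/
theorem mk_append_cancel (A B : List (ι × Bool)) (k : ι) (s : Bool) :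
    FreeGroup.mk (A ++ (k, s) :: (k, !s) :: B) = FreeGroup.mk (A ++ B) := by
  rw [mk_append, mk_cons_eq_sgen_mul, mk_cons_eq_sgen_mul, mk_append]
  simp [sgen_not]

/-- The gathered word is a permutation of the original one. [folklore] -/
theorem perm_caseI (W₁ T₁ T₂ U V : List (ι × Bool)) (q z : ι) (s σ : Bool) :
    (Block.word ⟨q, s, z, σ⟩ ++ (T₁ ++ V ++ W₁ ++ U ++ T₂)) ~
      (W₁ ++ (q, s) :: (T₁ ++ (z, σ) :: (T₂ ++ (q, !s) :: (U ++ (z, !σ) :: V)))) := by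
  rw [perm_iff_count]; intro a; simp only [Block.word, count_append, count_cons, count_nil]; omega

/-- **One gathering step, core** (case `ζ̄` after `p̄`): from the terminal quadratic word
`R = W₁ p T₁ ζ T₂ p̄ U ζ̄ V` with `T₁, ζ, T₂` of value `1`, an automorphism carrying
`[p, ζ] T₁ V W₁ U T₂` to a conjugate of `R`, fixing the other generators, sending `x_z` to a
word of value `1` in the letters of `R`, with the remainder `T₁ V W₁ U T₂` again terminal.
[cite: ZieschangVogtColdewey1980, 3.2.4, 5.2.8 (proof), E 5.4] -/
theorem step_core {G : Type*} [Group G] [DecidableEq G] (X : ι → G)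
    {R W₁ T₁ T₂ U V : List (ι × Bool)} {q z : ι} {s σ : Bool}
    (hR : R = W₁ ++ (q, s) :: (T₁ ++ (z, σ) :: (T₂ ++ (q, !s) :: (U ++ (z, !σ) :: V))))
    (hq : IsQuadratic R) (hz : X z = 1) (hT₁ : ∀ x ∈ T₁, X x.1 = 1) (hT₂ : ∀ x ∈ T₂, X x.1 = 1)
    (hZ : FreeGroup.mk (R.filter fun x => decide ¬ (X x.1 = 1)) = 1) :
    ∃ (ψ : MulAut (FreeGroup ι)) (Lz : List (ι × Bool)),
      ψ (FreeGroup.mk (Block.word ⟨q, s, z, σ⟩ ++ (T₁ ++ V ++ W₁ ++ U ++ T₂))) =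
        (FreeGroup.mk (W₁ ++ U ++ T₂))⁻¹ * FreeGroup.mk R * FreeGroup.mk (W₁ ++ U ++ T₂) ∧
      (∀ i, i ≠ q → i ≠ z → ψ (FreeGroup.of i) = FreeGroup.of i) ∧
      ψ (FreeGroup.of z) = FreeGroup.mk Lz ∧ (∀ k, Avoids k R → Avoids k Lz) ∧
      FreeGroup.lift X (FreeGroup.mk Lz) = 1 ∧
      FreeGroup.mk ((T₁ ++ V ++ W₁ ++ U ++ T₂).filter fun x => decide ¬ (X x.1 = 1)) = 1 := by
  obtain ⟨ψ, h1, h2, h3⟩ := gather_caseI hR hq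
  obtain ⟨⟨hqW₁, hqT₁, hqT₂, hqU, -⟩, ⟨hzW₁, hzT₁, hzT₂, hzU, -⟩, hqz⟩ := caseI_avoids hR hq
  -- the automorphism fixes `M = W₁ U T₂`
  have hM : ψ (FreeGroup.mk (W₁ ++ U ++ T₂)) = FreeGroup.mk (W₁ ++ U ++ T₂) := by
    refine map_mk_eq_self_of_forall ψ fun x hx => h2 _ ?_ ?_
    · simp only [mem_append] at hx
      rcases hx with (hx | hx) | hx
      · exact hqW₁ x hx
      · exact hqU x hx
      · exact hqT₂ x hx
    · simp only [mem_append] at hx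
      rcases hx with (hx | hx) | hx
      · exact hzW₁ x hx
      · exact hzU x hx
      · exact hzT₂ x hx
  -- value-one word for `x_z`
  have hval : FreeGroup.lift X (FreeGroup.mk (T₁ ++ (z, σ) :: T₂)) = 1 := by
    refine lift_mk_eq_one_of_forall X fun x hx => ?_
    simp only [mem_append, mem_cons] at hx
    rcases hx with hx | rfl | hx
    · exact hT₁ x hx
    · exact hz
    · exact hT₂ x hx
  have havoid : ∀ k, Avoids k R → Avoids k (T₁ ++ (z, σ) :: T₂) := by
    intro k hk x hx
    refine hk x ?_
    rw [hR]
    simp only [mem_append, mem_cons] at hx ⊢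
    tauto
  refine ⟨ψ, bif σ then T₁ ++ (z, σ) :: T₂ else FreeGroup.invRev (T₁ ++ (z, σ) :: T₂), ?_, h2, ?_, ?_, ?_, ?_⟩
  · -- certificate
    have e : Block.word ⟨q, s, z, σ⟩ ++ (T₁ ++ V ++ W₁ ++ U ++ T₂) =
        ((q, s) :: (z, σ) :: (q, !s) :: (z, !σ) :: (T₁ ++ V)) ++ (W₁ ++ U ++ T₂) := by
      simp [Block.word]
    have e' : (W₁ ++ U ++ T₂) ++ ((q, s) :: (z, σ) :: (q, !s) :: (z, !σ) :: (T₁ ++ V)) =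
        W₁ ++ U ++ T₂ ++ (q, s) :: (z, σ) :: (q, !s) :: (z, !σ) :: (T₁ ++ V) := rfl
    rw [e, mk_append_comm_eq_conj, map_mul, map_mul, map_inv, hM, e', h1]
  · -- `ψ x_z`
    cases σ
    · rw [cond_false, ← FreeGroup.inv_mk, ← h3, ← map_inv, ← sgen_not]; rfl
    · rw [cond_true, ← h3]; rfl
  · intro k hk
    cases σ
    · exact (havoid k hk).invRev
    · exact havoid k hk
  · cases σ
    · rw [cond_false, ← FreeGroup.inv_mk, map_inv, hval, inv_one]
    · rw [cond_true, hval]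
  · -- terminality of the remainder
    have hPz : ∀ t : Bool, (decide ¬ (X ((z, t) : ι × Bool).1 = 1)) = false := fun t => by simp [hz]
    have hPT₁ : (T₁.filter fun x => decide ¬ (X x.1 = 1)) = [] :=
      filter_eq_nil_iff.2 fun x hx => by simp [hT₁ x hx]
    have hPT₂ : (T₂.filter fun x => decide ¬ (X x.1 = 1)) = [] :=
      filter_eq_nil_iff.2 fun x hx => by simp [hT₂ x hx]
    rw [hR] at hZ
    simp only [filter_append, filter_cons, hPT₁, hPT₂, hPz, nil_append, Bool.false_eq_true,
      if_false] at hZ ⊢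
    by_cases hXq : X q = 1
    · simp only [hXq, not_true_eq_false, decide_false, Bool.false_eq_true, if_false] at hZ
      rw [append_nil, append_assoc]
      exact mk_append_eq_one_comm (by rwa [← append_assoc] at hZ)
    · simp only [hXq, not_false_eq_true, decide_true, if_true] at hZ
      rw [mk_append_cancel] at hZ
      rw [append_nil, append_assoc]
      exact mk_append_eq_one_comm (by rwa [← append_assoc] at hZ)

/-- **One gathering step** (ZVC 3.2.4 / proof of 5.2.8): in a nonempty terminal quadratic word `R` in
which every pair `p … p̄` interlinks some symbol of the enclosed segment, one handle can be
gathered: a block `[p, ζ]` followed by a terminal remainder, a permutation of `R`, is carried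
by an automorphism `ψ` to a conjugate `C R C⁻¹` of `R` by a word `C` in the letters of `R`;
`ψ` fixes all generators other than those of `p, ζ`, and sends `x_z` to a word of value `1` in
the letters of `R`. [cite: ZieschangVogtColdewey1980, 3.2.4, 5.2.8 (proof), E 5.4] -/
theorem exists_gather_step {G : Type*} [Group G] [DecidableEq G] (X : ι → G) {R : List (ι × Bool)}
    (hq : IsQuadratic R) (hne : R ≠ [])
    (hZ : FreeGroup.mk (R.filter fun x => decide ¬ (X x.1 = 1)) = 1)
    (horacle : ∀ (W₁ T W₂ : List (ι × Bool)) (q : ι) (s : Bool),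
      R = W₁ ++ (q, s) :: (T ++ (q, !s) :: W₂) → ∃ (z : ι) (σ : Bool), (z, σ) ∈ T ∧ (z, !σ) ∉ T) :
    ∃ (b : Block ι) (R' : List (ι × Bool)) (ψ : MulAut (FreeGroup ι)) (C Lz : List (ι × Bool)),
      (b.word ++ R') ~ R ∧
      ψ (FreeGroup.mk (b.word ++ R')) = FreeGroup.mk C * FreeGroup.mk R * (FreeGroup.mk C)⁻¹ ∧
      (∀ k, Avoids k R → Avoids k C) ∧
      (∀ i, i ≠ b.q → i ≠ b.z → ψ (FreeGroup.of i) = FreeGroup.of i) ∧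
      ψ (FreeGroup.of b.z) = FreeGroup.mk Lz ∧ (∀ k, Avoids k R → Avoids k Lz) ∧
      FreeGroup.lift X (FreeGroup.mk Lz) = 1 ∧
      FreeGroup.mk (R'.filter fun x => decide ¬ (X x.1 = 1)) = 1 := by
  obtain ⟨W₁, T, W₂, q, s, hR, hT⟩ := exists_innermost X hq hne hZ
  obtain ⟨z, σ, hzT, hzT'⟩ := horacle W₁ T W₂ q s hR
  obtain ⟨T₁, T₂, rfl⟩ := append_of_mem hzT
  have hz : X z = 1 := hT _ hzT
  have hT₁ : ∀ x ∈ T₁, X x.1 = 1 := fun x hx => hT x (mem_append_left _ hx)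
  have hT₂ : ∀ x ∈ T₂, X x.1 = 1 := fun x hx => hT x (mem_append_right _ (mem_cons_of_mem _ hx))
  -- `z ≠ q`
  have hsplit : IsQuadratic (W₁ ++ (q, s) :: ((T₁ ++ (z, σ) :: T₂) ++ (q, !s) :: W₂)) := hR ▸ hq
  obtain ⟨-, hqT, -⟩ := hsplit.avoids_of_split
  have hzq : z ≠ q := hqT (z, σ) (by simp)
  -- locate `ζ̄`
  have hpart : (z, !σ) ∈ R := hq.partner_mem (x := (z, σ)) (by rw [hR]; simp)
  rw [hR] at hpart
  simp only [mem_append, mem_cons, Prod.mk.injEq] at hpart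
  have hnotT₁ : (z, !σ) ∉ T₁ := fun h => hzT' (mem_append_left _ h)
  have hnotT₂ : (z, !σ) ∉ T₂ := fun h => hzT' (mem_append_right _ (mem_cons_of_mem _ h))
  have hσσ : (!σ) ≠ σ := by cases σ <;> decide
  rcases hpart with hW₁ | ⟨hzq', -⟩ | (hT₁' | ⟨-, hσ'⟩ | hT₂') | ⟨hzq', -⟩ | hW₂
  · -- case II: `ζ̄` before `p`; rotate first
    obtain ⟨U₀, V₀, rfl⟩ := append_of_mem hW₁
    set R₁ := ([] : List (ι × Bool)) ++ (q, s) :: (T₁ ++ (z, σ) :: (T₂ ++ (q, !s) :: ((W₂ ++ U₀) ++ (z, !σ) :: V₀)))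
      with hR₁
    have eMN : R = (U₀ ++ (z, !σ) :: V₀) ++ ((q, s) :: (T₁ ++ (z, σ) :: (T₂ ++ (q, !s) :: W₂))) := by
      rw [hR]; simp
    have eNM : R₁ = ((q, s) :: (T₁ ++ (z, σ) :: (T₂ ++ (q, !s) :: W₂))) ++ (U₀ ++ (z, !σ) :: V₀) := by
      rw [hR₁]; simp
    have hperm : R₁ ~ R := by rw [eMN, eNM]; exact perm_append_comm
    have hq₁ : IsQuadratic R₁ := by rw [eNM]; exact (eMN ▸ hq).rotate
    have hZ₁ : FreeGroup.mk (R₁.filter fun x => decide ¬ (X x.1 = 1)) = 1 := by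
      rw [eNM, filter_append]
      refine mk_append_eq_one_comm ?_
      rw [← filter_append, ← eMN]; exact hZ
    obtain ⟨ψ, Lz, h1, h2, h3, h4, h5, h6⟩ := step_core X hR₁ hq₁ hz hT₁ hT₂ hZ₁
    have havoidR : ∀ k, Avoids k R → Avoids k R₁ := fun k hk x hx => hk x (hperm.mem_iff.1 hx)
    refine ⟨⟨q, s, z, σ⟩, T₁ ++ V₀ ++ [] ++ (W₂ ++ U₀) ++ T₂, ψ,
      FreeGroup.invRev ((U₀ ++ (z, !σ) :: V₀) ++ ([] ++ (W₂ ++ U₀) ++ T₂)), Lz,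
      (perm_caseI [] T₁ T₂ (W₂ ++ U₀) V₀ q z s σ).trans hperm, ?_, ?_, h2, h3,
      fun k hk => h4 k (havoidR k hk), h5, h6⟩
    · rw [h1, ← FreeGroup.inv_mk, inv_inv, mk_append (U₀ ++ (z, !σ) :: V₀), eNM,
        mk_append_comm_eq_conj (U₀ ++ (z, !σ) :: V₀), ← eMN]
      group
    · intro k hk
      refine Avoids.invRev fun x hx => hk x ?_
      rw [hR]
      simp only [mem_append, mem_cons, nil_append] at hx ⊢
      tauto
  · exact absurd hzq' hzq
  · exact absurd hT₁' hnotT₁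
  · exact absurd hσ' hσσ
  · exact absurd hT₂' hnotT₂
  · exact absurd hzq' hzq
  · -- case I
    obtain ⟨U, V, rfl⟩ := append_of_mem hW₂
    have hR' : R = W₁ ++ (q, s) :: (T₁ ++ (z, σ) :: (T₂ ++ (q, !s) :: (U ++ (z, !σ) :: V))) := by
      rw [hR]; simp
    obtain ⟨ψ, Lz, h1, h2, h3, h4, h5, h6⟩ := step_core X hR' hq hz hT₁ hT₂ hZ
    refine ⟨⟨q, s, z, σ⟩, T₁ ++ V ++ W₁ ++ U ++ T₂, ψ, FreeGroup.invRev (W₁ ++ U ++ T₂), Lz,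
      hR' ▸ perm_caseI W₁ T₁ T₂ U V q z s σ, ?_, ?_, h2, h3, h4, h5, h6⟩
    · rw [h1, ← FreeGroup.inv_mk, inv_inv]
    · intro k hk
      refine Avoids.invRev fun x hx => hk x ?_
      rw [hR]
      simp only [mem_append, mem_cons] at hx ⊢
      tauto

/-! ### The endgame -/

/-- Removing a self-partnered prefix (one containing the formal inverse of each of its letters)
from a quadratic word leaves a quadratic word. [folklore] -/
theorem IsQuadratic.of_append_partnered {A R : List (ι × Bool)} (hq : IsQuadratic (A ++ R))
    (hA : ∀ x ∈ A, (x.1, !x.2) ∈ A) : IsQuadratic R := by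
  intro i
  have h1 := hq.count_le_one (i, true)
  have h2 := hq.count_le_one (i, false)
  have h3 := (hq i).1
  simp only [count_append] at h1 h2 h3
  by_cases ht : (i, true) ∈ A
  · have hf : (i, false) ∈ A := hA _ ht
    have := count_pos_iff.2 ht
    have := count_pos_iff.2 hf
    constructor <;> omega
  · have hf : (i, false) ∉ A := fun hf => ht (hA _ hf)
    rw [count_eq_zero_of_not_mem ht] at h1 h3
    rw [count_eq_zero_of_not_mem hf] at h2 h3
    constructor <;> omega

/-- In a quadratic word `A ++ R` with `A` self-partnered, no symbol of `R` occurs in `A`.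
[folklore] -/
theorem IsQuadratic.not_mem_of_partnered {A R : List (ι × Bool)} (hq : IsQuadratic (A ++ R))
    (hA : ∀ x ∈ A, (x.1, !x.2) ∈ A) {x : ι × Bool} (hx : x ∈ R) (t : Bool) : (x.1, t) ∉ A := by
  intro ht
  have hxA : x ∈ A := by
    by_cases hxt : x.2 = t
    · have : x = (x.1, t) := Prod.ext rfl hxt
      rwa [this]
    · have : x = (x.1, !t) := Prod.ext rfl (by cases t <;> cases h : x.2 <;> simp_all)
      rw [this]; exact hA _ ht
  have h1 := hq.count_le_one x
  rw [count_append] at h1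
  have := count_pos_iff.2 hxA
  have := count_pos_iff.2 hx
  omega

omit [DecidableEq ι] in
/-- **Values after an automorphism**: `X̂ (Θ y)` is the evaluation of `y` under the transformed
assignment `i ↦ X̂ (Θ xᵢ)`. [folklore] -/
theorem lift_mulAut_apply {G : Type*} [Group G] (X : ι → G) (Θ : MulAut (FreeGroup ι))
    (y : FreeGroup ι) :
    FreeGroup.lift X (Θ y) = FreeGroup.lift (fun i => FreeGroup.lift X (Θ (FreeGroup.of i))) y := by
  change ((FreeGroup.lift X).comp Θ.toMonoidHom) y = _
  congr 1
  exact FreeGroup.ext_hom _ _ fun a => by simp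

/-- **The endgame, inductive form**: with a gathered prefix `blocksWord Gb` whose killed symbols
have value `1` and a terminal quadratic remainder `R`, nondegenerate together, all of `R` can be
gathered into further blocks. [cite: ZieschangVogtColdewey1980, 3.2.4, 5.2.8 (proof), E 5.4] -/
theorem endgame_aux [Fintype ι] {G : Type*} [Group G] [DecidableEq G] (n : ℕ) :
    ∀ (Gb : List (Block ι)) (R : List (ι × Bool)) (X : ι → G), R.length ≤ n →
      IsQuadratic (blocksWord Gb ++ R) → Nondeg (blocksWord Gb ++ R) →
      (∀ b ∈ Gb, X b.z = 1) →
      FreeGroup.mk (R.filter fun x => decide ¬ (X x.1 = 1)) = 1 →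
      ∃ (Nb : List (Block ι)) (Θ : MulAut (FreeGroup ι)) (c : FreeGroup ι),
        blocksWord (Gb ++ Nb) ~ blocksWord Gb ++ R ∧
        Θ (FreeGroup.mk (blocksWord (Gb ++ Nb))) = c * FreeGroup.mk (blocksWord Gb ++ R) * c⁻¹ ∧
        ∀ b ∈ Gb ++ Nb, FreeGroup.lift X (Θ (FreeGroup.of b.z)) = 1 := by
  induction n with
  | zero =>
    intro Gb R X hlen _ _ hG _
    obtain rfl : R = [] := length_eq_zero_iff.1 (Nat.le_zero.1 hlen)
    refine ⟨[], 1, 1, by simp, by simp, fun b hb => ?_⟩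
    rw [append_nil] at hb
    rw [MulAut.one_apply, FreeGroup.lift_apply_of, hG b hb]
  | succ n ih =>
    intro Gb R X hlen hq hN hG hZ
    by_cases hR0 : R = []
    · subst hR0
      refine ⟨[], 1, 1, by simp, by simp, fun b hb => ?_⟩
      rw [append_nil] at hb
      rw [MulAut.one_apply, FreeGroup.lift_apply_of, hG b hb]
    have hGpart : ∀ x ∈ blocksWord Gb, (x.1, !x.2) ∈ blocksWord Gb := fun x hx => partner_mem_blocksWord hx
    have hqR : IsQuadratic R := hq.of_append_partnered hGpart
    -- the interlinking oracle, from nondegeneracy of the whole word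
    have horacle : ∀ (W₁ T W₂ : List (ι × Bool)) (q : ι) (s : Bool),
        R = W₁ ++ (q, s) :: (T ++ (q, !s) :: W₂) → ∃ (z : ι) (σ : Bool), (z, σ) ∈ T ∧ (z, !σ) ∉ T := by
      intro W₁ T W₂ q s hR
      exact hN.exists_interlinked hq (W₁ := blocksWord Gb ++ W₁) (T := T) (W₂ := W₂) (p := q) (s := s)
        (by rw [hR]; simp)
    obtain ⟨b, R', ψ, C, Lz, hperm, hcert, hC, hfix, hLz, hLzav, hval, hZ'⟩ :=
      exists_gather_step X hqR hR0 hZ horacle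
    -- the symbols of the gathered prefix
    let p : ι → Prop := fun i => (i, true) ∈ blocksWord Gb ∨ (i, false) ∈ blocksWord Gb
    have hGp : ∀ x ∈ blocksWord Gb, p x.1 := by
      intro x hx
      cases ht : x.2
      · right; have : x = (x.1, false) := Prod.ext rfl ht; rwa [← this]
      · left; have : x = (x.1, true) := Prod.ext rfl ht; rwa [← this]
    have hRp : ∀ x ∈ R, ¬ p x.1 := fun x hx hp =>
      hp.elim (hq.not_mem_of_partnered hGpart hx true) (hq.not_mem_of_partnered hGpart hx false)
    have hRav : ∀ k, p k → Avoids k R := fun k hk y hy hyk => hRp y hy (hyk ▸ hk)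
    have hCp : ∀ x ∈ C, ¬ p x.1 := fun x hx hp => hC x.1 (hRav _ hp) x hx rfl
    have hLzp : ∀ x ∈ Lz, ¬ p x.1 := fun x hx hp => hLzav x.1 (hRav _ hp) x hx rfl
    have hbR : ∀ x ∈ b.word ++ R', x ∈ R := fun x hx => hperm.mem_iff.1 hx
    have hbq : ¬ p b.q := hRp _ (hbR (b.q, b.s) (by simp [Block.word]))
    have hbz : ¬ p b.z := hRp _ (hbR (b.z, b.σ) (by simp [Block.word]))
    -- the conjugation fix-up and the step automorphism on the whole word
    let τ := conjOnAut p C hCp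
    let Θ₁ := τ * ψ
    have hψG : ψ (FreeGroup.mk (blocksWord Gb)) = FreeGroup.mk (blocksWord Gb) :=
      map_mk_eq_self_of_forall ψ fun x hx =>
        hfix x.1 (fun h => hbq (h ▸ hGp x hx)) (fun h => hbz (h ▸ hGp x hx))
    have hcert₁ : Θ₁ (FreeGroup.mk (blocksWord Gb ++ (b.word ++ R'))) =
        FreeGroup.mk C * FreeGroup.mk (blocksWord Gb ++ R) * (FreeGroup.mk C)⁻¹ := by
      simp only [Θ₁, τ, MulAut.mul_apply, mk_append (blocksWord Gb), map_mul, map_inv, hψG, hcert,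
        conjOnAut_apply, conjOn_mk_of_forall p _ hGp, conjOn_mk_of_forall_not p _ hCp,
        conjOn_mk_of_forall_not p _ hRp]
      group
    -- the new values
    set X₁ : ι → G := fun i => FreeGroup.lift X (Θ₁ (FreeGroup.of i)) with hX₁
    have hG₁ : ∀ b' ∈ Gb ++ [b], X₁ b'.z = 1 := by
      intro b' hb'
      rw [mem_append, mem_singleton] at hb'
      rcases hb' with hb' | rfl
      · have hpz : p b'.z := hGp (b'.z, b'.σ) (mem_flatMap.2 ⟨b', hb', by simp [Block.word]⟩)
        simp only [hX₁, Θ₁, τ, MulAut.mul_apply]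
        rw [hfix b'.z (fun h => hbq (h ▸ hpz)) (fun h => hbz (h ▸ hpz)), conjOnAut_apply, conjOn_of,
          if_pos hpz, map_mul, map_mul, map_inv, FreeGroup.lift_apply_of, hG b' hb']
        group
      · simp only [hX₁, Θ₁, τ, MulAut.mul_apply]
        rw [hLz, conjOnAut_apply, conjOn_mk_of_forall_not p _ hLzp, hval]
    have hqbR' : IsQuadratic (b.word ++ R') := hqR.perm hperm.symm
    have hR'p : ∀ x ∈ R', ¬ p x.1 := fun x hx => hRp x (hbR x (mem_append_right _ hx))
    have hX₁R' : ∀ x ∈ R', X₁ x.1 = X x.1 := by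
      intro x hx
      have hxq : x.1 ≠ b.q := fun h =>
        hqbR'.not_mem_of_partnered (fun y hy => b.partner_mem_word hy) hx b.s (by simp [Block.word, h])
      have hxz : x.1 ≠ b.z := fun h =>
        hqbR'.not_mem_of_partnered (fun y hy => b.partner_mem_word hy) hx b.σ (by simp [Block.word, h])
      simp only [hX₁, Θ₁, τ, MulAut.mul_apply]
      rw [hfix x.1 hxq hxz, conjOnAut_apply, conjOn_of, if_neg (hR'p x hx), FreeGroup.lift_apply_of]
    have hZ₁ : FreeGroup.mk (R'.filter fun x => decide ¬ (X₁ x.1 = 1)) = 1 := by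
      rw [filter_congr fun x hx => by rw [hX₁R' x hx]]; exact hZ'
    have ebw : blocksWord (Gb ++ [b]) ++ R' = blocksWord Gb ++ (b.word ++ R') := by
      rw [blocksWord_append, blocksWord_singleton, append_assoc]
    have hperm₁ : (blocksWord (Gb ++ [b]) ++ R') ~ (blocksWord Gb ++ R) := by
      rw [ebw]; exact hperm.append_left _
    have hq₁ : IsQuadratic (blocksWord (Gb ++ [b]) ++ R') := hq.perm hperm₁.symm
    have hN₁ : Nondeg (blocksWord (Gb ++ [b]) ++ R') :=
      hN.transport hq.isBalanced Θ₁ (FreeGroup.mk C) (by rw [ebw]; exact hcert₁)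
    have hlen₁ : R'.length ≤ n := by
      have := hperm.length_eq
      simp only [length_append, Block.word, length_cons, length_nil] at this
      omega
    obtain ⟨Nb', Θ', c', hperm', hcert', hvals'⟩ := ih (Gb ++ [b]) R' X₁ hlen₁ hq₁ hN₁ hG₁ hZ₁
    have eG : Gb ++ b :: Nb' = Gb ++ [b] ++ Nb' := by simp
    refine ⟨b :: Nb', Θ₁ * Θ', Θ₁ c' * FreeGroup.mk C, ?_, ?_, ?_⟩
    · rw [eG]; exact hperm'.trans hperm₁
    · rw [eG, MulAut.mul_apply, hcert', map_mul, map_mul, map_inv, ebw, hcert₁]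
      group
    · intro b'' hb''
      rw [MulAut.mul_apply, lift_mulAut_apply X Θ₁]
      exact hvals' b'' (by rw [eG] at hb''; exact hb'')

/-- **Gathering all handles** (ZVC E 5.4, by 3.2.4 and the proof of 5.2.8): for a quadratic word `w` with
nondegenerate form and an assignment of values under which `w` is terminal (trivial after
deleting the letters of value `1`), some automorphism carries a product of commutator blocks,
a permutation of the letters of `w`, to a conjugate of `w`, with all second slots of the blocks
of value `1` under the transformed assignment. [cite: ZieschangVogtColdewey1980, E 5.4] -/
theorem exists_blocks_of_terminal [Fintype ι] {G : Type*} [Group G] [DecidableEq G] (X : ι → G)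
    {w : List (ι × Bool)} (hq : IsQuadratic w) (hN : Nondeg w)
    (hZ : FreeGroup.mk (w.filter fun x => decide ¬ (X x.1 = 1)) = 1) :
    ∃ (bs : List (Block ι)) (Θ : MulAut (FreeGroup ι)) (c : FreeGroup ι),
      blocksWord bs ~ w ∧ Θ (FreeGroup.mk (blocksWord bs)) = c * FreeGroup.mk w * c⁻¹ ∧
      ∀ b ∈ bs, FreeGroup.lift X (Θ (FreeGroup.of b.z)) = 1 := by
  obtain ⟨Nb, Θ, c, h1, h2, h3⟩ :=
    endgame_aux w.length [] w X le_rfl (by simpa using hq) (by simpa using hN) (by simp) hZ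
  exact ⟨Nb, Θ, c, by simpa using h1, by simpa using h2, by simpa using h3⟩

end Literature.GroupTheory.CombinatorialGroupTheory
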